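import Summits.AtomisticToContinuum.BoseEinsteinCondensation.Theses.BECSubharmonicContinuation
import Summits.AtomisticToContinuum.BoseEinsteinCondensation.Theorems.BECSubharmonicContinuationFreeGasCase
import Literature.MathematicalPhysics.QuantumManyBody.PeriodicBoseGasRelabelling
import Literature.MathematicalPhysics.QuantumManyBody.WeightedCorrector
import HarnessLib

/-!
# Route BECSubharmonicContinuation — the cell-free door `CoreContinuation` (stmt-AtomisticToContinuum-14570)

The glue of the cell-free door of route BECSubharmonicContinuation: the crux
`CoreSubharmonicCoherence` (the Newtonian potential at the origin of the positive part of the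
kinetic coherence `H_Ψ(i, ·)` beyond ONE healing length `ξ = (8πρa)^{-1/2}` is `≤ 1/8` for periodic
near-minimisers) implies the Target `PeriodicBEC` (constant-mode BEC, `n₀ ≥ N/8`, for periodic
near-minimisers on the thermodynamic torus `L = (N/ρ)^{1/3}` at all small densities).

This file proves the bookkeeping `coreContinuation_of`: given the three analytic supports of the
route as hypotheses BY NAME (`HarmonicMinorant`, `CoreDeficitBounds`, `BallCriterion`; their `_holds`
theorems are separate items), `CoreContinuation` follows. The remaining supports are discharged
here: `ScatteringLengthFinite` by `IsRepulsiveFiniteRange.scatteringLength_ne_top`, `FreeGasCase`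
by the landed `freeGasCase_proof`, and the one genuinely quantitative input — the per-particle
kinetic energy of a near-minimiser, `t = H_Ψ(i,0) = T/N ≤ 4πρa(1 + 1/8) + 1/N` — by Bose symmetry
(`lintegral_kineticSlot_eq`: all particles carry the same kinetic energy), `T ≤ ⟨Ψ, HΨ⟩ ≤ E₀ + 1`
and the PROVED Dyson–LSSY upper bound `LSSY2005_upperBound_periodic_holds`
(`E₀^per ≤ 4πρ₁a(1 + C a/b)N`, `ρ₁ = (N-1)/L³ ≤ ρ`, `a/b = a(4πρ₁/3)^{1/3} ≤ 1/(8C)` for `ρ < ρ₁`).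

Arithmetic (LSSY units `ħ = 2m = 1`, `ξ² = 1/(8πρa)`): with `R = ξ`, `S = L/2` in
`HarmonicMinorant`, the core term is `≤ tξ²/2 ≤ 9/32 + 1/(16πρaN) ≤ 9/32 + 1/64`
(`CoreDeficitBounds` (a), `N ≥ 4/(πρa)`), the middle term is `tξ³/(L/2) ≤ (9πρa + 2)ξ³/L ≤ 1/64`
(`L ≥ 64(9πρa+2)ξ³`), the shell term is `≤ 1/8` (the crux); so `1 - ⨍_{B_{L/2}} G ≤ 7/16`, i.e.
`⨍ G ≥ 9/16`, and `BallCriterion` gives `n₀ ≥ (2·9/16 - 1)N = N/8`.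

## References

* [LSSY2005] E. H. Lieb, R. Seiringer, J. P. Solovej, J. Yngvason, *The Mathematics of the Bose
  Gas and its Condensation*, Birkhäuser 2005: Thm. 2.2 (2.14) (upper bound), §1.2 (1.17)–(1.19).
-/

noncomputable section

namespace Summit.AtomisticToContinuum.BoseEinsteinCondensation.Theorems

open Literature.MathematicalPhysics.QuantumManyBody.BoseGas
open _root_.MeasureTheory _root_.Filter _root_.Topology
open scoped ENNReal NNReal ComplexConjugate
open Summit.AtomisticToContinuum.BoseEinsteinCondensation.Theses.BECSubharmonicContinuation

variable {N : ℕ} {L : ℝ}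

/-- The partial derivatives `∂_{i,k}Ψ` of a periodic trial state are continuous. [folklore] -/
theorem continuous_fderiv_kineticSlot (Ψ : PeriodicTrialState N L) (i : Fin N) (k : Fin 3) :
    Continuous fun X : Config N =>
      fderiv ℝ Ψ.ψ X (Pi.single i (EuclideanSpace.single k (1 : ℝ))) :=
  (Ψ.contDiff.continuous_fderiv one_ne_zero).clm_apply continuous_const

/-- **The kinetic coherence at the origin is the one-particle kinetic energy**:
`H_Ψ(i, 0) = Re ∑ₖ ∫ conj(∂_{i,k}Ψ) ∂_{i,k}Ψ = ∫_{cell^N} ∑ₖ |∂_{i,k}Ψ|²` (as the real value of the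
`ℝ≥0∞` cell integral). [folklore] -/
theorem kineticCoherence_zero_eq_toReal (Ψ : PeriodicTrialState N L) (i : Fin N) :
    (∑ k : Fin 3, ∫ X in cellN N L,
        conj (fderiv ℝ Ψ.ψ (Function.update X i (X i + 0))
          (Pi.single i (EuclideanSpace.single k (1 : ℝ)))) *
          fderiv ℝ Ψ.ψ X (Pi.single i (EuclideanSpace.single k (1 : ℝ)))).re =
      (∫⁻ X in cellN N L, ∑ k : Fin 3,
        (‖fderiv ℝ Ψ.ψ X (Pi.single i (EuclideanSpace.single k (1 : ℝ)))‖₊ : ℝ≥0∞) ^ 2).toReal := by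
  simp only [add_zero, Function.update_eq_self]
  have hcont := continuous_fderiv_kineticSlot Ψ i
  -- each summand is the integral of a real square
  have hk : ∀ k : Fin 3, (∫ X in cellN N L,
      conj (fderiv ℝ Ψ.ψ X (Pi.single i (EuclideanSpace.single k (1 : ℝ)))) *
        fderiv ℝ Ψ.ψ X (Pi.single i (EuclideanSpace.single k (1 : ℝ)))) =
      ((∫ X in cellN N L,
        ‖fderiv ℝ Ψ.ψ X (Pi.single i (EuclideanSpace.single k (1 : ℝ)))‖ ^ 2 : ℝ) : ℂ) := by
    intro k
    rw [← integral_complex_ofReal]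
    refine integral_congr_ae (Eventually.of_forall fun X => ?_)
    simp only [Complex.conj_mul', Complex.ofReal_pow]
  simp_rw [hk]
  have hint : ∀ k : Fin 3, Integrable (fun X : Config N =>
      ‖fderiv ℝ Ψ.ψ X (Pi.single i (EuclideanSpace.single k (1 : ℝ)))‖ ^ 2)
      (volume.restrict (cellN N L)) := fun k => integrableOn_cellN ((hcont k).norm.pow 2) L
  rw [← Complex.ofReal_sum, Complex.ofReal_re, ← integral_finsetSum _ (fun k _ => hint k)]
  rw [integral_eq_lintegral_of_nonneg_ae (Eventually.of_forall fun X =>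
      Finset.sum_nonneg fun k _ => sq_nonneg _)
    ((continuous_finsetSum _ fun k _ => (hcont k).norm.pow 2).aestronglyMeasurable)]
  congr 1
  refine lintegral_congr fun X => ?_
  rw [ENNReal.ofReal_sum_of_nonneg (fun k _ => sq_nonneg _)]
  refine Finset.sum_congr rfl fun k _ => ?_
  rw [coe_nnnorm_sq_eq_ofReal]

/-- **Bose symmetry of the one-particle kinetic energies**: `∫ ∑ₖ |∂_{j,k}Ψ|² = ∫ ∑ₖ |∂_{i,k}Ψ|²`
for all particles `i, j` (relabel by the transposition `(i j)`, under which `Ψ` and the cell are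
invariant). [folklore] -/
theorem lintegral_kineticSlot_eq (Ψ : PeriodicTrialState N L) (i j : Fin N) :
    (∫⁻ X in cellN N L, ∑ k : Fin 3,
        (‖fderiv ℝ Ψ.ψ X (Pi.single j (EuclideanSpace.single k (1 : ℝ)))‖₊ : ℝ≥0∞) ^ 2) =
      ∫⁻ X in cellN N L, ∑ k : Fin 3,
        (‖fderiv ℝ Ψ.ψ X (Pi.single i (EuclideanSpace.single k (1 : ℝ)))‖₊ : ℝ≥0∞) ^ 2 := by
  set σ : Equiv.Perm (Fin N) := Equiv.swap i j with hσ
  have hdiff : Differentiable ℝ Ψ.ψ := Ψ.contDiff.differentiable one_ne_zero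
  -- chain rule for the relabelling `X ↦ X ∘ σ`, under which `Ψ` is invariant
  have hcomp : (Ψ.ψ ∘ relabelCLM σ) = Ψ.ψ := funext fun Z => by
    rw [Function.comp_apply, relabelCLM_apply, Ψ.symm]
  have hfd : ∀ (X : Config N) (w : Space),
      fderiv ℝ Ψ.ψ X (Pi.single j w) = fderiv ℝ Ψ.ψ (X ∘ σ) (Pi.single i w) := by
    intro X w
    have h2 : fderiv ℝ Ψ.ψ X = (fderiv ℝ Ψ.ψ (relabelCLM σ X)).comp (relabelCLM σ) := by
      have := fderiv_comp X (hdiff (relabelCLM σ X)) (relabelCLM σ).differentiableAt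
      rwa [hcomp, (relabelCLM σ).fderiv] at this
    rw [h2, ContinuousLinearMap.comp_apply, relabelCLM_apply, relabelCLM_apply,
      single_comp_perm, hσ, Equiv.symm_swap, Equiv.swap_apply_right]
  simp_rw [hfd]
  exact setLIntegral_cellN_comp_perm σ (fun X => ∑ k : Fin 3,
    (‖fderiv ℝ Ψ.ψ X (Pi.single i (EuclideanSpace.single k (1 : ℝ)))‖₊ : ℝ≥0∞) ^ 2)

/-- **Equipartition bound**: `N ∫ ∑ₖ |∂_{i,k}Ψ|² = ∫ |∇Ψ|² ≤ ⟨Ψ, HΨ⟩` for every particle `i`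
(Bose symmetry and positivity of the interaction). [folklore] -/
theorem natCast_mul_lintegral_kineticSlot_le (v : ℝ → ℝ≥0∞) (Ψ : PeriodicTrialState N L)
    (i : Fin N) :
    (N : ℝ≥0∞) * (∫⁻ X in cellN N L, ∑ k : Fin 3,
        (‖fderiv ℝ Ψ.ψ X (Pi.single i (EuclideanSpace.single k (1 : ℝ)))‖₊ : ℝ≥0∞) ^ 2) ≤
      periodicEnergy v Ψ := by
  have hmeas : ∀ j : Fin N, Measurable fun X : Config N => ∑ k : Fin 3,
      (‖fderiv ℝ Ψ.ψ X (Pi.single j (EuclideanSpace.single k (1 : ℝ)))‖₊ : ℝ≥0∞) ^ 2 :=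
    fun j => Finset.measurable_sum _ fun k _ =>
      ((measurable_fderiv_apply_const ℝ Ψ.ψ _).nnnorm.coe_nnreal_ennreal).pow_const 2
  calc (N : ℝ≥0∞) * (∫⁻ X in cellN N L, ∑ k : Fin 3,
        (‖fderiv ℝ Ψ.ψ X (Pi.single i (EuclideanSpace.single k (1 : ℝ)))‖₊ : ℝ≥0∞) ^ 2)
      = ∑ j : Fin N, ∫⁻ X in cellN N L, ∑ k : Fin 3,
        (‖fderiv ℝ Ψ.ψ X (Pi.single j (EuclideanSpace.single k (1 : ℝ)))‖₊ : ℝ≥0∞) ^ 2 := by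
        simp_rw [lintegral_kineticSlot_eq Ψ i]
        rw [Finset.sum_const, Finset.card_univ, Fintype.card_fin, nsmul_eq_mul]
    _ = ∫⁻ X in cellN N L, kineticDensity Ψ.ψ X := by
        rw [← lintegral_finsetSum _ fun j _ => hmeas j]
        rfl
    _ ≤ periodicEnergy v Ψ := lintegral_mono fun _ => le_self_add

/-- **Kinetic coherence at the origin against the energy**: if `⟨Ψ, HΨ⟩ ≤ E < ∞` then
`N · H_Ψ(i, 0) ≤ E` for every particle `i`. [folklore] -/
theorem natCast_mul_kineticCoherence_zero_le (v : ℝ → ℝ≥0∞) (Ψ : PeriodicTrialState N L)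
    (i : Fin N) {E : ℝ≥0∞} (hE : periodicEnergy v Ψ ≤ E) (hEtop : E ≠ ⊤) :
    (N : ℝ) * (∑ k : Fin 3, ∫ X in cellN N L,
        conj (fderiv ℝ Ψ.ψ (Function.update X i (X i + 0))
          (Pi.single i (EuclideanSpace.single k (1 : ℝ)))) *
          fderiv ℝ Ψ.ψ X (Pi.single i (EuclideanSpace.single k (1 : ℝ)))).re ≤ E.toReal := by
  rw [kineticCoherence_zero_eq_toReal, ← ENNReal.toReal_natCast, ← ENNReal.toReal_mul]
  exact ENNReal.toReal_mono hEtop ((natCast_mul_lintegral_kineticSlot_le v Ψ i).trans hE)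

/-- The kinetic coherence at the origin is non-negative. [folklore] -/
theorem kineticCoherence_zero_nonneg (Ψ : PeriodicTrialState N L) (i : Fin N) :
    0 ≤ (∑ k : Fin 3, ∫ X in cellN N L,
        conj (fderiv ℝ Ψ.ψ (Function.update X i (X i + 0))
          (Pi.single i (EuclideanSpace.single k (1 : ℝ)))) *
          fderiv ℝ Ψ.ψ X (Pi.single i (EuclideanSpace.single k (1 : ℝ)))).re := by
  rw [kineticCoherence_zero_eq_toReal]
  exact ENNReal.toReal_nonneg

/-- **The cell-free door, glue** (stmt-AtomisticToContinuum-14570 modulo the analytic supports of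
the route, taken BY NAME): `HarmonicMinorant → CoreDeficitBounds → BallCriterion → CoreContinuation`,
i.e. given the three supports, `CoreSubharmonicCoherence → PeriodicBEC` with `c = 1/8`.
Proof: `a ≠ ⊤` (finite range); `a = 0` is `freeGasCase_proof`; for `0 < a < ∞` take
`ρ₀ = min ρ_crux (3(c′/a)³/(4π))`, `c′ = min c (1/(8C))` from the LSSY upper bound, and for
`N` large (`N ≥ 2`, `2R₀ < L`, `2ξ ≤ L`, `64(9πρa+2)ξ³ ≤ L`, `N ≥ 4/(πρa)`) the slack
`δ = min δ_crux 1`; then `t = H(i,0) ≤ (9/2)πρa + 1/N` (`natCast_mul_kineticCoherence_zero_le`),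
core `≤ 9/32 + 1/64`, middle `≤ 1/64`, shell `≤ 1/8`, `⨍_{B_{L/2}} G ≥ 9/16`, `n₀ ≥ N/8`.
[cite: LSSY2005, Thm. 2.2 (2.14); §1.2 (1.17)–(1.19)] -/
theorem coreContinuation_of (hHM : HarmonicMinorant) (hCD : CoreDeficitBounds) (hBC : BallCriterion) :
    CoreContinuation := by
  unfold CoreContinuation
  intro hCore v hv
  have hfin : scatteringLength v ≠ ⊤ := hv.scatteringLength_ne_top
  by_cases ha0 : scatteringLength v = 0
  · exact freeGasCase_proof v hv ha0
  have hapos : 0 < scatteringLength v := pos_iff_ne_zero.2 ha0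
  obtain ⟨ρc, hρc, hcore⟩ := hCore v hv hfin hapos
  obtain ⟨R₀, hR₀⟩ := hv.2
  obtain ⟨C, c, hC, hc, hUB⟩ := LSSY2005_upperBound_periodic_holds v R₀ hv.1 hR₀ hfin
  set a : ℝ := (scatteringLength v).toReal with ha_def
  have ha : 0 < a := ENNReal.toReal_pos ha0 hfin
  -- smallness threshold on the density: `a (4πρ/3)^{1/3} < c' := min c (1/(8C))`
  set c' : ℝ := min c (1 / (8 * C)) with hc'
  have hc'pos : 0 < c' := lt_min hc (by positivity)
  set ρ₁ : ℝ := 3 * (c' / a) ^ 3 / (4 * Real.pi) with hρ₁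
  have hρ₁pos : 0 < ρ₁ := by positivity
  refine ⟨min ρc ρ₁, lt_min hρc hρ₁pos, fun ρ hρ hρlt => ⟨1 / 8, by norm_num, ?_⟩⟩
  have hρc' : ρ < ρc := hρlt.trans_le (min_le_left _ _)
  have hρ₁' : ρ < ρ₁ := hρlt.trans_le (min_le_right _ _)
  -- the healing length
  set ξ : ℝ := (Real.sqrt (8 * Real.pi * ρ * a))⁻¹ with hξ
  have h8 : 0 < 8 * Real.pi * ρ * a := by positivity
  have hξpos : 0 < ξ := inv_pos.2 (Real.sqrt_pos.2 h8)
  have hξ2 : ξ ^ 2 = (8 * Real.pi * ρ * a)⁻¹ := by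
    rw [hξ, inv_pow, Real.sq_sqrt h8.le]
  -- the events in `N`
  have hLt := tendsto_sideLength_atTop hρ
  filter_upwards [hcore ρ hρ hρc', eventually_ge_atTop 2, hLt.eventually_gt_atTop (2 * R₀),
    hLt.eventually_ge_atTop (2 * ξ),
    hLt.eventually_ge_atTop (64 * (9 * Real.pi * ρ * a + 2) * ξ ^ 3),
    tendsto_natCast_atTop_atTop.eventually_ge_atTop (4 / (Real.pi * ρ * a))] with N hN hN2 hLR
    hLξ hLmid hNbig
  obtain ⟨δ₁, hδ₁, hΨall⟩ := hN
  have hN0 : 0 < N := by omega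
  have hNpos : (0 : ℝ) < N := Nat.cast_pos.2 hN0
  have hL : 0 < sideLength ρ N := sideLength_pos_of_pos hρ hN0
  have hρL : (N : ℝ) / sideLength ρ N ^ 3 = ρ := div_sideLength_pow_three hρ hN0
  generalize sideLength ρ N = L at hL hρL hLR hLξ hLmid hΨall ⊢
  refine ⟨min δ₁ 1, lt_min hδ₁ one_pos, fun Ψ hΨE => ?_⟩
  set i : Fin N := ⟨0, hN0⟩ with hidef
  have hE₁ : periodicEnergy v Ψ ≤ periodicGroundStateEnergy v N L + δ₁ :=
    hΨE.trans (add_le_add le_rfl (min_le_left _ _))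
  have hE1 : periodicEnergy v Ψ ≤ periodicGroundStateEnergy v N L + 1 :=
    hΨE.trans (add_le_add le_rfl (min_le_right _ _))
  -- (1) the shell bound from the crux
  have hshell := hΨall Ψ hE₁ i
  rw [← ha_def, ← hξ] at hshell
  -- (2) the LSSY upper bound: `E₀ + 1 ≤ (9/2)πρaN + 1`
  set ρe : ℝ := ((N : ℝ) - 1) / L ^ 3 with hρe
  have hρe_le : ρe ≤ ρ := by
    rw [hρe, ← hρL]
    exact div_le_div_of_nonneg_right (by linarith) (by positivity)
  have hρe_pos : 0 < ρe := by
    rw [hρe]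
    have : (2 : ℝ) ≤ N := by exact_mod_cast hN2
    exact div_pos (by linarith) (by positivity)
  have hx_pos : 0 < 4 * Real.pi * ρe / 3 := by positivity
  have hab_eq : a / (4 * Real.pi * ρe / 3) ^ (-(1 : ℝ) / 3) =
      a * (4 * Real.pi * ρe / 3) ^ ((1 : ℝ) / 3) := by
    rw [show (-(1 : ℝ) / 3) = -(1 / 3) by norm_num, Real.rpow_neg hx_pos.le, div_inv_eq_mul]
  have hab_lt : a * (4 * Real.pi * ρe / 3) ^ ((1 : ℝ) / 3) < c' := by
    have h1 : (4 * Real.pi * ρe / 3) ^ ((1 : ℝ) / 3) ≤ (4 * Real.pi * ρ / 3) ^ ((1 : ℝ) / 3) :=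
      Real.rpow_le_rpow hx_pos.le (by gcongr) (by norm_num)
    have h2 : (4 * Real.pi * ρ / 3) ^ ((1 : ℝ) / 3) < (4 * Real.pi * ρ₁ / 3) ^ ((1 : ℝ) / 3) :=
      Real.rpow_lt_rpow (by positivity) (by gcongr) (by norm_num)
    have h3 : (4 * Real.pi * ρ₁ / 3) ^ ((1 : ℝ) / 3) = c' / a := by
      rw [hρ₁]
      have : 4 * Real.pi * (3 * (c' / a) ^ 3 / (4 * Real.pi)) / 3 = (c' / a) ^ 3 := by
        field_simp
      rw [this, show ((1 : ℝ) / 3) = ((3 : ℕ) : ℝ)⁻¹ by norm_num,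
        Real.pow_rpow_inv_natCast (by positivity) three_ne_zero]
    calc a * (4 * Real.pi * ρe / 3) ^ ((1 : ℝ) / 3)
        < a * (c' / a) := mul_lt_mul_of_pos_left (h1.trans_lt (h2.trans_eq h3)) ha
      _ = c' := by field_simp
  have hab_c : a / (4 * Real.pi * ρe / 3) ^ (-(1 : ℝ) / 3) ≤ c := by
    rw [hab_eq]; exact hab_lt.le.trans (min_le_left _ _)
  have hab_C : C * (a / (4 * Real.pi * ρe / 3) ^ (-(1 : ℝ) / 3)) ≤ 1 / 8 := by
    rw [hab_eq]
    have h1 : a * (4 * Real.pi * ρe / 3) ^ ((1 : ℝ) / 3) ≤ 1 / (8 * C) :=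
      hab_lt.le.trans (min_le_right _ _)
    calc C * (a * (4 * Real.pi * ρe / 3) ^ ((1 : ℝ) / 3)) ≤ C * (1 / (8 * C)) :=
          mul_le_mul_of_nonneg_left h1 hC.le
      _ = 1 / 8 := by field_simp
  have hU := hUB N L hN2 hL hLR
  simp only at hU
  have hE0 : periodicGroundStateEnergy v N L ≤
      ENNReal.ofReal (9 / 2 * Real.pi * ρ * a * N) := by
    refine (hU hab_c).trans (ENNReal.ofReal_le_ofReal ?_)
    have h0 : 0 ≤ 1 + C * (a / (4 * Real.pi * ρe / 3) ^ (-(1 : ℝ) / 3)) := by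
      rw [hab_eq]; positivity
    calc 4 * Real.pi * ρe * a * (1 + C * (a / (4 * Real.pi * ρe / 3) ^ (-(1 : ℝ) / 3))) * N
        ≤ 4 * Real.pi * ρ * a * (1 + 1 / 8) * N := by gcongr
      _ = 9 / 2 * Real.pi * ρ * a * N := by ring
  have hEtop : periodicGroundStateEnergy v N L + 1 ≠ ⊤ :=
    ENNReal.add_ne_top.2 ⟨ne_top_of_le_ne_top ENNReal.ofReal_ne_top hE0, ENNReal.one_ne_top⟩
  have hEreal : (periodicGroundStateEnergy v N L + 1).toReal ≤ 9 / 2 * Real.pi * ρ * a * N + 1 := by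
    refine ENNReal.toReal_le_of_le_ofReal (by positivity) ?_
    rw [ENNReal.ofReal_add (by positivity) zero_le_one, ENNReal.ofReal_one]
    exact add_le_add hE0 le_rfl
  -- (3) the one-particle kinetic energy `t = H(i,0) ≤ (9/2)πρa + 1/N`
  have ht := (natCast_mul_kineticCoherence_zero_le v Ψ i hE1 hEtop).trans hEreal
  have ht0 := kineticCoherence_zero_nonneg Ψ i
  set t : ℝ := (∑ k : Fin 3, ∫ X in cellN N L,
        conj (fderiv ℝ Ψ.ψ (Function.update X i (X i + 0))
          (Pi.single i (EuclideanSpace.single k (1 : ℝ)))) *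
          fderiv ℝ Ψ.ψ X (Pi.single i (EuclideanSpace.single k (1 : ℝ)))).re with htdef
  have ht' : t ≤ 9 / 2 * Real.pi * ρ * a + 1 / N := by
    rw [← le_div_iff₀' hNpos] at ht
    calc t ≤ (9 / 2 * Real.pi * ρ * a * N + 1) / N := ht
      _ = 9 / 2 * Real.pi * ρ * a + 1 / N := by field_simp
  -- (4) the harmonic minorant and the core deficit bound at `R = ξ`, `S = L/2`
  have hHM' := hHM N L hL Ψ i ξ (L / 2) hξpos (by linarith)
  have hCD' := (hCD N L hL Ψ i ξ hξpos).1
  -- (5) arithmetic: core ≤ 9/32 + 1/64, middle ≤ 1/64, shell ≤ 1/8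
  have hcore2 : t * ξ ^ 2 / 2 ≤ 9 / 32 + 1 / 64 := by
    have h1 : t * ξ ^ 2 / 2 ≤ (9 / 2 * Real.pi * ρ * a + 1 / N) * ξ ^ 2 / 2 := by
      gcongr
    have h2 : (9 / 2 * Real.pi * ρ * a + 1 / N) * ξ ^ 2 / 2 =
        9 / 32 + 1 / (16 * Real.pi * ρ * a * N) := by
      rw [hξ2]
      field_simp
      ring
    have h3 : 1 / (16 * Real.pi * ρ * a * N) ≤ 1 / 64 := by
      refine one_div_le_one_div_of_le (by norm_num) ?_
      have := (div_le_iff₀ (by positivity : (0 : ℝ) < Real.pi * ρ * a)).1 hNbig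
      linarith
    linarith
  have hmid : t * ξ ^ 3 / (L / 2) ≤ 1 / 64 := by
    have h1 : t ≤ 9 / 2 * Real.pi * ρ * a + 1 := by
      have : 1 / (N : ℝ) ≤ 1 := by
        rw [div_le_one hNpos]; exact_mod_cast hN0
      linarith
    have hξ3 : 0 < ξ ^ 3 := by positivity
    calc t * ξ ^ 3 / (L / 2) = 2 * t * ξ ^ 3 / L := by
          field_simp
        _ ≤ 2 * (9 / 2 * Real.pi * ρ * a + 1) * ξ ^ 3 / L := by
          gcongr
        _ = (9 * Real.pi * ρ * a + 2) * ξ ^ 3 / L := by ring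
        _ ≤ 1 / 64 := by
          rw [div_le_iff₀ hL]
          linarith
  have havg : (9 : ℝ) / 16 ≤ ⨍ y in Metric.ball (0 : EuclideanSpace ℝ (Fin 3)) (L / 2),
      (∫ X in cellN N L, conj (Ψ.ψ (Function.update X i (X i + y))) * Ψ.ψ X).re := by
    linarith
  -- (6) the ball criterion
  have hB := hBC N L (9 / 16) hL Ψ i havg
  convert hB using 2
  ring

end Summit.AtomisticToContinuum.BoseEinsteinCondensation.Theorems

end
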